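import Summits.CriticalPhenomena.PercolationContinuityZ3.Theorems.Transplant.FKConnectivityAllQExchange
import Summits.CriticalPhenomena.PercolationContinuityZ3.Theorems.PercNearOneGluingNoHeavyLowerTailFKExactEval
import HarnessLib

/-!
# Connectivity correlation inequalities for `φ_{w,q}` — the exchange inequality K₀ FAILS for small `q`: refutation of the node
# `ExchangeAdjFKPos` by an exact computation on `K₄` minus an edge at `q = 1/100`

Support file (`--supports stmt-CriticalPhenomena-4575`), FK sub-lane `prim-bschramm-fk-1` (gen 8) of the post-continuity
programme; builds on p205010 (kernel theorem, internal audit signed; external expert review pending).  One `abbrev` family (the listed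
weighted graph), no named facts, no sorries; standard axioms (`decide`, no `native_decide`).

FINDING (this seat, the same day the node was filed).  Along the arboreal-gas rays `p_e = λ_e q`, `q ↓ 0`, the exchange inequality
K₀ of `…Exchange.lean` tends to a statement about weighted spanning FORESTS,
`Φ^𝒰₁₁Φ₀₀ + Φ^𝒰₁₀Φ₀₁ ≥ Φ^𝒰₀₁Φ₁₀ + Φ^𝒰₀₀Φ₁₁` (`Φ_{ab}` = weighted count of forests containing the forced pairs), and THAT statement is
false for generic weights (9/200 random instances on `≤ 6` vertices, 18/600 on `≤ 5`; it holds for uniform weights in all tests).  Hence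
K₀ itself fails for small `q` in a window around `p ≈ λq`.  WITNESS: `V = Fin 4`, listed pairs `01, 13, 12, 03, 02` (`K₄` minus `23`),
parameters `(·, 1/10, ·, 3/100, 1/20)`, `q = 1/100`, root `x = 1`, `f = 10`, `g = 12`, `𝒰 = {S ∋ 2, 3}`:
`Z₁₀Z₀₁(u₀₁ − u₁₀) = 5016745541/4·10¹⁸ > 246794849/2·10¹⁷ = Z₁₁Z₀₀(u₁₁ − u₀₀)` (relative gap ≈ 1.6 %).  On the same instance MM holds
with room: in the quadratic `W_f(v_g) = a + b·v_g + c·v_g²` of the module docstring of `…Exchange.lean`, `b = −0.049·2√(ac)`.  So: the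
linear coefficient of the two-pair expansion CAN be negative; MM (`ClusterDomAdjFKPos`, census-clean, also in the forest limit) is
not reachable from K₀ for all `q`, only where K₀ holds (every `q ≥ 1`: `…ExchangeOneLe.lean`; and, empirically, `q ≥ 1/50` on
`≤ 6` vertices).  (refuted-substantive for the node as filed `∀ q > 0`; the natural repair 'K₀ for `q ∈ [q₀,1)`' has no determined `q₀`.)
[cite: Grimmett2006, §1.4 eq. (1.20) (p. 15); §3.9 (p. 63)] [cite: AyyerLinussonRavichandran2025, §7 Conj. 7.1 (p. 22)]
-/

noncomputable section

namespace Summit.CriticalPhenomena.PercolationContinuityZ3.Theorems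

namespace FK

open MeasureTheory Set Literature.Probability.LatticeModels Literature.Probability.Percolation
open scoped Classical

namespace ExchangeCex

/-- The listed weighted graph `K₄ − 23` on `Fin 4`: pairs `01, 13, 12, 03, 02` with parameters `(a, 1/10, b, 3/100, 1/20)` and
`q = 1/100`; `a`, `b` are the states of the two special pairs `f = 01`, `g = 12`. [cite: Grimmett2006, §1.4 eq. (1.20) (p. 15)] -/
abbrev dab (a b : ℚ) : RCEval := ⟨4, 5, ![0, 1, 1, 0, 0], ![1, 3, 2, 3, 2], ![a, 1 / 10, b, 3 / 100, 1 / 20], 1 / 100⟩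

/-- Validity of the base data set (both special parameters `½`). [folklore] -/
theorem valid_hh : (dab (1 / 2) (1 / 2)).Valid := by decide +kernel
/-- Validity, state `(1,1)`. [folklore] -/
theorem valid_11 : (dab 1 1).Valid := by decide +kernel
/-- Validity, state `(1,0)`. [folklore] -/
theorem valid_10 : (dab 1 0).Valid := by decide +kernel
/-- Validity, state `(0,1)`. [folklore] -/
theorem valid_01 : (dab 0 1).Valid := by decide +kernel
/-- Validity, state `(0,0)`. [folklore] -/
theorem valid_00 : (dab 0 0).Valid := by decide +kernel

/-- Computable predicate of `{C_1 ∋ 2, 3}`. [folklore] -/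
def pU (a b : ℚ) (t : Finset (Fin 5)) : Bool := (dab a b).reachB t 1 2 && (dab a b).reachB t 1 3

/-- `Z₁₁`. [cite: Grimmett2006, §1.4 eq. (1.20) (p. 15)] -/
theorem z11 : (dab 1 1).ZQ = 13573 / 10000000 := by decide +kernel
/-- `Z₁₀`. [cite: Grimmett2006, §1.4 eq. (1.20) (p. 15)] -/
theorem z10 : (dab 1 0).ZQ = 1615187 / 20000000000 := by decide +kernel
/-- `Z₀₁`. [cite: Grimmett2006, §1.4 eq. (1.20) (p. 15)] -/
theorem z01 : (dab 0 1).ZQ = 2179487 / 20000000000 := by decide +kernel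
/-- `Z₀₀`. [cite: Grimmett2006, §1.4 eq. (1.20) (p. 15)] -/
theorem z00 : (dab 0 0).ZQ = 5149487 / 2000000000000 := by decide +kernel

/-- Mass of `{C_1 ∋ 2,3}`, state `(1,1)`. [cite: Grimmett2006, §1.4 eq. (1.20) (p. 15)] -/
theorem m11 : (dab 1 1).massQ (pU 1 1) = 127 / 100000 := by decide +kernel
/-- Mass of `{C_1 ∋ 2,3}`, state `(1,0)`. [cite: Grimmett2006, §1.4 eq. (1.20) (p. 15)] -/
theorem m10 : (dab 1 0).massQ (pU 1 0) = 127 / 2000000 := by decide +kernel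
/-- Mass of `{C_1 ∋ 2,3}`, state `(0,1)`. [cite: Grimmett2006, §1.4 eq. (1.20) (p. 15)] -/
theorem m01 : (dab 0 1).massQ (pU 0 1) = 20243 / 200000000 := by decide +kernel
/-- Mass of `{C_1 ∋ 2,3}`, state `(0,0)`. [cite: Grimmett2006, §1.4 eq. (1.20) (p. 15)] -/
theorem m00 : (dab 0 0).massQ (pU 0 0) = 3 / 2000000 := by decide +kernel

/-- The up-set `{S ∋ 2, 3}`. [folklore] -/
theorem isUpperSet_U : IsUpperSet {S : Set (Fin 4) | (2 : Fin 4) ∈ S ∧ (3 : Fin 4) ∈ S} :=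
  fun _ _ h hS => ⟨h hS.1, h hS.2⟩

/-- `conf t ∈ {C_1 ∋ 2, 3}` iff `pU`. [folklore] -/
theorem conf_mem_iff (a b : ℚ) (t : Finset (Fin 5)) :
    (dab a b).conf t ∈ clusterIn (1 : Fin 4) {S : Set (Fin 4) | (2 : Fin 4) ∈ S ∧ (3 : Fin 4) ∈ S} ↔ pU a b t = true := by
  unfold pU
  rw [Bool.and_eq_true, RCEval.reachB_iff, RCEval.reachB_iff]
  rfl

/-- **The parameter vectors of `dab a b` are the two-point updates of that of `dab ½ ½`.** [cite: Grimmett2006, §1.4 eq. (1.20) (p. 15)] -/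
theorem dab_w (a b : ℚ) (hv : (dab a b).Valid) (A B : unitInterval) (hA : (A : ℝ) = a) (hB : (B : ℝ) = b) :
    ((dab a b).w : Sym2 (Fin 4) → unitInterval) =
      Function.update (Function.update ((dab (1 / 2) (1 / 2)).w : Sym2 (Fin 4) → unitInterval)
        s((1 : Fin 4), (0 : Fin 4)) A) s((1 : Fin 4), (2 : Fin 4)) B := by
  have hv0 := valid_hh
  have hedge : (dab a b).edge = (dab (1 / 2) (1 / 2)).edge := rfl
  have e2 : (dab a b).edge 2 = s((1 : Fin 4), (2 : Fin 4)) := rfl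
  have e0 : (dab a b).edge 0 = s((1 : Fin 4), (0 : Fin 4)) := Sym2.eq_swap
  funext e
  by_cases h2 : e = s((1 : Fin 4), (2 : Fin 4))
  · subst h2
    rw [Function.update_self]
    apply Subtype.ext
    rw [hB, ← e2, RCEval.w_edge hv 2]
    rfl
  · rw [Function.update_of_ne h2]
    by_cases h0 : e = s((1 : Fin 4), (0 : Fin 4))
    · subst h0
      rw [Function.update_self]
      apply Subtype.ext
      rw [hA, ← e0, RCEval.w_edge hv 0]
      rfl
    · rw [Function.update_of_ne h0]
      apply Subtype.ext
      by_cases hr : e ∈ Set.range (dab a b).edge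
      · obtain ⟨i, rfl⟩ := hr
        have hi0 : i ≠ 0 := fun h => h0 (by rw [h, e0])
        have hi2 : i ≠ 2 := fun h => h2 (by rw [h, e2])
        rw [RCEval.w_edge hv i, hedge, RCEval.w_edge hv0 i]
        fin_cases i <;> simp_all
      · rw [RCEval.w_eq_zero_of_notMem_range hr]
        rw [hedge] at hr
        rw [RCEval.w_eq_zero_of_notMem_range hr]

end ExchangeCex

open ExchangeCex

/-- **The exchange inequality fails for small `q`: `¬ ExchangeAdjFKPos`.**  Witness: `K₄ − 23` on `Fin 4` with parameters
`(·, 1/10, ·, 3/100, 1/20)` on `01, 13, 12, 03, 02`, `q = 1/100`, `x = 1`, `f = 10`, `g = 12`, `𝒰 = {S ∋ 2, 3}`: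
`Z₁₀Z₀₁(u₀₁−u₁₀) = 5016745541/4·10¹⁸ > 246794849/2·10¹⁷ = Z₁₁Z₀₀(u₁₁−u₀₀)`.  (refuted-substantive: the arboreal-gas limit of K₀ is
false for generic weights; the reduction `K₀ ⇒ MM` of `…Exchange.lean` stands but cannot be fed for small `q`; MM itself holds here.)
[cite: Grimmett2006, §1.4 eq. (1.20) (p. 15); §3.9 (p. 63)] -/
theorem not_exchangeAdjFKPos : ¬ ExchangeAdjFKPos := by
  intro h
  have hq : (0 : ℝ) < ((1 / 100 : ℚ) : ℝ) := by norm_num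
  have key := h ((1 / 100 : ℚ) : ℝ) hq 4 (dab (1 / 2) (1 / 2)).w 1 0 1 2
    {S : Set (Fin 4) | (2 : Fin 4) ∈ S ∧ (3 : Fin 4) ∈ S} isUpperSet_U (SimpleGraph.Reachable.refl _)
  have c1 : ((1 : unitInterval) : ℝ) = ((1 : ℚ) : ℝ) := by simp
  have c0 : ((0 : unitInterval) : ℝ) = ((0 : ℚ) : ℝ) := by simp
  set X : Set (BondConfig (Fin 4)) := clusterIn (1 : Fin 4) {S : Set (Fin 4) | (2 : Fin 4) ∈ S ∧ (3 : Fin 4) ∈ S} with hX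
  -- the same inequality with the four parameter vectors written as `(dab a b).w` (decidability instances reconciled by `convert`)
  have key2 : rcPartitionFunctionW (dab 1 0).w ((1 / 100 : ℚ) : ℝ) ∅ * rcPartitionFunctionW (dab 0 1).w ((1 / 100 : ℚ) : ℝ) ∅ *
        ((rcMeasureW (dab 0 1).w ((1 / 100 : ℚ) : ℝ) ∅).real X - (rcMeasureW (dab 1 0).w ((1 / 100 : ℚ) : ℝ) ∅).real X) ≤
      rcPartitionFunctionW (dab 1 1).w ((1 / 100 : ℚ) : ℝ) ∅ * rcPartitionFunctionW (dab 0 0).w ((1 / 100 : ℚ) : ℝ) ∅ *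
        ((rcMeasureW (dab 1 1).w ((1 / 100 : ℚ) : ℝ) ∅).real X - (rcMeasureW (dab 0 0).w ((1 / 100 : ℚ) : ℝ) ∅).real X) := by
    rw [dab_w 1 1 valid_11 1 1 c1 c1, dab_w 1 0 valid_10 1 0 c1 c0, dab_w 0 1 valid_01 0 1 c0 c1, dab_w 0 0 valid_00 0 0 c0 c0]
    convert key
  have hq11 : ((1 / 100 : ℚ) : ℝ) = (((dab 1 1).q : ℚ) : ℝ) := rfl
  rw [hq11] at key2
  rw [RCEval.rcPartitionFunctionW_eq valid_11, RCEval.rcPartitionFunctionW_eq valid_10, RCEval.rcPartitionFunctionW_eq valid_01,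
    RCEval.rcPartitionFunctionW_eq valid_00,
    RCEval.real_eq_massQ_div valid_11 (P := pU 1 1) (conf_mem_iff 1 1),
    RCEval.real_eq_massQ_div valid_10 (P := pU 1 0) (conf_mem_iff 1 0),
    RCEval.real_eq_massQ_div valid_01 (P := pU 0 1) (conf_mem_iff 0 1),
    RCEval.real_eq_massQ_div valid_00 (P := pU 0 0) (conf_mem_iff 0 0),
    z11, z10, z01, z00, m11, m10, m01, m00] at key2
  norm_num at key2

end FK

end Summit.CriticalPhenomena.PercolationContinuityZ3.Theorems

end
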